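import Summits.RiemannHypothesis.RiemannHypothesis.Theorems.ThetaTier2CellLoop
import HarnessLib

/-!
# THETA tier-2 kernel checker — the per-cell envelope bounds COLLECTED along `stage1` (cc-s2-1, WEIL typing lane; RH-FREE)

(K1), loop level, part 2 (HOME/cc-s2-1/gen22/TIER2-KERNEL-SPEC.md §5 (K1) / §6(a) second half).  `stage1 A` pushes, cell by cell, the three
values `S_j`, `e_j`, `e′_j` onto REVERSED lists; this file proves that entry `j` (from the front of the re-reversed list, `j < Jt`) bounds the
real E1/E2/E3 envelopes on the CLOSED depth cell `[jτ, (j+1)τ]`: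

  `S(t) ≤ envS A j`,  `e^{−(m+½)t}·S(t)·c̄_j ≤ envE A j`,  `e^{−t/2}·[(½M₀e^{−mt}S(t) + M₁₀e^{−(m−1)t}S₁(t))·c̄_j + M₀e^{−mt}S(t)·c̄′_j] ≤ envEp A j`

(`stage1_envS_le`, `stage1_envE_le`, `stage1_envEp_le`), where `envS/envE/envEp A j := val ((stage1 A).sRev/eRev/epRev.reverse.getD j 0)` are the
exported real sequences of SPEC §5 and `c̄, c̄′ : ℕ → ℝ` are any cut values enclosed by the kernel's (`0 ≤ c̄_j ≤ val (cutC A j)`,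
`0 ≤ c̄′_j ≤ val (cutCp A j)`).  Hypotheses: the atoms enclose (`CellAtoms`), `θ₀ ∈ [val th0L, val th0H]`, and four decidable data facts
(`0 < th0L`, `S ≤ etL`, `S ≤ etH`, `K·(stage1 A).hi ≤ 2²⁴·S` — the size side condition of LEMMA S at the LAST cell, which dominates every
cell because the upper ends increase).  Ingredients: `cellStep_S/e/ep` (ThetaTier2CellStep), `cellLoop_inv` (ThetaTier2CellLoop), and the
bookkeeping of `(x :: l).reverse = l.reverse ++ [x]`.  These are exactly the `env j` hypotheses of the abstract E3/E4 lemmas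
(`WeilColumnThetaCellNorms`, `WeilColumnThetaLagConvolution`).  Nothing here bears on the truth of RH.
-/

set_option linter.dupNamespace false  -- the mandated namespace repeats `RiemannHypothesis`
set_option autoImplicit false

namespace Summit.RiemannHypothesis.RiemannHypothesis.Theorems.ThetaTier2

open Real

/-! ## List bookkeeping for the reversed accumulators -/

/-- Below the old length, consing does not change the re-reversed list. [folklore] -/
theorem getD_reverse_cons_of_lt {x i : ℕ} {l : List ℕ} (hi : i < l.length) :
    (x :: l).reverse.getD i 0 = l.reverse.getD i 0 := by
  rw [List.reverse_cons, List.getD_eq_getElem?_getD, List.getD_eq_getElem?_getD,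
    List.getElem?_append_left (by rw [List.length_reverse]; exact hi)]

/-- The consed element is entry `l.length` of the re-reversed list. [folklore] -/
theorem getD_reverse_cons_of_eq {x i : ℕ} {l : List ℕ} (hi : i = l.length) : (x :: l).reverse.getD i 0 = x := by
  subst hi
  rw [List.reverse_cons, List.getD_eq_getElem?_getD, List.getElem?_append_right (by rw [List.length_reverse])]
  simp

/-! ## The cut values as the kernel reads them -/

/-- The kernel's cut value `c_j` for cell `j` (`= S`, i.e. `1`, beyond the cut layer or past the list). [this cell, TIER2-KERNEL-SPEC §1] -/
def cutC (A : Inp) (j : ℕ) : ℕ := if j < A.ncut then A.cList.getD j S else S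

/-- The kernel's cut-derivative value `c′_j` for cell `j` (`= 0` beyond the cut layer). [this cell, TIER2-KERNEL-SPEC §1] -/
def cutCp (A : Inp) (j : ℕ) : ℕ := if j < A.ncut then A.cpList.getD j 0 else 0

/-! ## The collected bounds as a predicate on the loop state -/

/-- At cell index `j` the state's three reversed lists have length `j` and their re-reversed entries `i < j` bound `S`, `e`, `e′` on the closed
cell `i` (for the cut values `cb`, `cpb`). [this cell, TIER2-KERNEL-SPEC §5 (K1)] -/
structure CellBounds (A : Inp) (θ₀ τ M₀ M₁₀ c₂ ε R Rm : ℝ) (cb cpb : ℕ → ℝ) (j : ℕ) (st : St) : Prop where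
  len_s : st.sRev.length = j
  len_e : st.eRev.length = j
  len_ep : st.epRev.length = j
  S_le : ∀ i < j, ∀ t : ℝ, (i : ℝ) * τ ≤ t → t ≤ ((i : ℝ) + 1) * τ →
    Sfun θ₀ R A.m A.K t ≤ val (st.sRev.reverse.getD i 0)
  e_le : ∀ i < j, ∀ t : ℝ, (i : ℝ) * τ ≤ t → t ≤ ((i : ℝ) + 1) * τ →
    exp (-(A.m + 1 / 2 : ℝ) * t) * Sfun θ₀ R A.m A.K t * cb i ≤ val (st.eRev.reverse.getD i 0)
  ep_le : ∀ i < j, ∀ t : ℝ, (i : ℝ) * τ ≤ t → t ≤ ((i : ℝ) + 1) * τ →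
    exp (-(1 / 2 : ℝ) * t) * ((M₀ / 2 * exp (-(A.m : ℝ) * t) * Sfun θ₀ R A.m A.K t
        + M₁₀ * exp (-(A.m - 1 : ℝ) * t) * S1fun θ₀ c₂ ε Rm A.m A.K t) * cb i
        + M₀ * exp (-(A.m : ℝ) * t) * Sfun θ₀ R A.m A.K t * cpb i) ≤ val (st.epRev.reverse.getD i 0)

/-- The empty initial state satisfies `CellBounds` at `j = 0`. [this cell] -/
theorem CellBounds.init (A : Inp) (θ₀ τ M₀ M₁₀ c₂ ε R Rm : ℝ) (cb cpb : ℕ → ℝ) (lo hi emh em em1 eh : ℕ) :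
    CellBounds A θ₀ τ M₀ M₁₀ c₂ ε R Rm cb cpb 0
      { lo := lo, hi := hi, emh := emh, em := em, em1 := em1, eh := eh, eRev := [], epRev := [], sRev := [] } :=
  ⟨rfl, rfl, rfl, fun i hi => absurd hi (Nat.not_lt_zero i), fun i hi => absurd hi (Nat.not_lt_zero i),
    fun i hi => absurd hi (Nat.not_lt_zero i)⟩

/-! ## One step -/

/-- The upper end after a step (a field that does not depend on the harmonic sums). [this cell] -/
theorem cellStep_hi (A : Inp) (j : ℕ) (st : St) : (cellStep A j st).hi = mulU st.hi A.etH := by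
  unfold cellStep
  dsimp only

/-- **One step collects one more cell**: `CellBounds` at `j` and the invariant at `j` give `CellBounds` at `j+1` for `cellStep A j st`
(size side condition of LEMMA S at this cell as a hypothesis). [this cell, TIER2-KERNEL-SPEC §5 (K1)] -/
theorem cellStep_bounds (A : Inp) {θ₀ τ M₀ M₁₀ c₂ ε R Rm : ℝ} (hA : CellAtoms A θ₀ τ M₀ M₁₀ c₂ ε R Rm)
    {cb cpb : ℕ → ℝ} (hcb : ∀ i, 0 ≤ cb i ∧ cb i ≤ val (cutC A i)) (hcpb : ∀ i, 0 ≤ cpb i ∧ cpb i ≤ val (cutCp A i))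
    {j : ℕ} {st : St} (hinv : CellInv A θ₀ τ j st) (hb : CellBounds A θ₀ τ M₀ M₁₀ c₂ ε R Rm cb cpb j st)
    (hsz : (A.K : ℝ) * val (mulU st.hi A.etH) ≤ 2 ^ 24) :
    CellBounds A θ₀ τ M₀ M₁₀ c₂ ε R Rm cb cpb (j + 1) (cellStep A j st) := by
  obtain ⟨hs, he, hep⟩ := cellStep_heads A j st
  have hcbj := hcb j
  have hcpbj := hcpb j
  unfold cutC at hcbj
  unfold cutCp at hcpbj
  refine ⟨?_, ?_, ?_, ?_, ?_, ?_⟩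
  · rw [hs, List.length_cons, hb.len_s]
  · rw [he, List.length_cons, hb.len_e]
  · rw [hep, List.length_cons, hb.len_ep]
  · intro i hi t ht1 ht2
    rcases Nat.lt_succ_iff_lt_or_eq.1 hi with hi' | hi'
    · rw [hs, getD_reverse_cons_of_lt (by rw [hb.len_s]; exact hi')]
      exact hb.S_le i hi' t ht1 ht2
    · subst hi'
      have hv := cellStep_S A hA hinv hsz ht1 ht2
      rw [hs, List.headD_cons] at hv
      rw [hs, getD_reverse_cons_of_eq hb.len_s.symm]
      exact hv
  · intro i hi t ht1 ht2
    rcases Nat.lt_succ_iff_lt_or_eq.1 hi with hi' | hi'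
    · rw [he, getD_reverse_cons_of_lt (by rw [hb.len_e]; exact hi')]
      exact hb.e_le i hi' t ht1 ht2
    · subst hi'
      have hv := cellStep_e A hA hinv hsz hcbj.1 hcbj.2 ht1 ht2
      rw [he, List.headD_cons] at hv
      rw [he, getD_reverse_cons_of_eq hb.len_e.symm]
      exact hv
  · intro i hi t ht1 ht2
    rcases Nat.lt_succ_iff_lt_or_eq.1 hi with hi' | hi'
    · rw [hep, getD_reverse_cons_of_lt (by rw [hb.len_ep]; exact hi')]
      exact hb.ep_le i hi' t ht1 ht2
    · subst hi'
      have hv := cellStep_ep A hA hinv hsz hcbj.1 hcbj.2 hcpbj.1 hcpbj.2 ht1 ht2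
      rw [hep, List.headD_cons] at hv
      rw [hep, getD_reverse_cons_of_eq hb.len_ep.symm]
      exact hv

/-! ## The loop -/

/-- The upper ends of the θ-interval increase along the loop (`S ≤ A.etH`, i.e. `e^{τ} ≥ 1`). [this cell] -/
theorem le_cellLoop_hi (A : Inp) (heH : S ≤ A.etH) :
    ∀ fuel j : ℕ, ∀ st : St, st.hi ≤ (cellLoop A fuel j st).hi := by
  intro fuel
  induction fuel with
  | zero => intro j st; rw [cellLoop_zero]
  | succ fuel ih =>
    intro j st
    rw [cellLoop_succ]
    refine le_trans ?_ (ih (j + 1) (cellStep A j st))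
    rw [cellStep_hi]
    exact le_mulU_of_S_le heH

/-- **The loop collects all cells**: `CellInv` + `CellBounds` at `j` ⇒ `CellBounds` at `j + fuel` for `cellLoop A fuel j st`, the size side
condition being assumed at the END of the loop only. [this cell, TIER2-KERNEL-SPEC §5 (K1)] -/
theorem cellLoop_bounds (A : Inp) {θ₀ τ M₀ M₁₀ c₂ ε R Rm : ℝ} (hA : CellAtoms A θ₀ τ M₀ M₁₀ c₂ ε R Rm)
    (he : S ≤ A.etL) (heH : S ≤ A.etH)
    {cb cpb : ℕ → ℝ} (hcb : ∀ i, 0 ≤ cb i ∧ cb i ≤ val (cutC A i)) (hcpb : ∀ i, 0 ≤ cpb i ∧ cpb i ≤ val (cutCp A i)) :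
    ∀ fuel j : ℕ, ∀ st : St, CellInv A θ₀ τ j st → CellBounds A θ₀ τ M₀ M₁₀ c₂ ε R Rm cb cpb j st →
      (A.K : ℝ) * val (cellLoop A fuel j st).hi ≤ 2 ^ 24 →
      CellBounds A θ₀ τ M₀ M₁₀ c₂ ε R Rm cb cpb (j + fuel) (cellLoop A fuel j st) := by
  intro fuel
  induction fuel with
  | zero => intro j st _ hb _; rw [cellLoop_zero]; simpa using hb
  | succ fuel ih =>
    intro j st hinv hb hsz
    rw [cellLoop_succ] at hsz ⊢
    have hsz' : (A.K : ℝ) * val (mulU st.hi A.etH) ≤ 2 ^ 24 := by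
      refine le_trans (mul_le_mul_of_nonneg_left (val_mono ?_) (Nat.cast_nonneg _)) hsz
      rw [← cellStep_hi]
      exact le_cellLoop_hi A heH fuel (j + 1) (cellStep A j st)
    have hb1 := cellStep_bounds A hA hcb hcpb hinv hb hsz'
    have hinv1 : CellInv A θ₀ τ (j + 1) (cellStep A j st) :=
      cellStep_inv A hA hinv (by have := cellStep_lo_pos A j st hinv.lo_pos he; rwa [cellStep_lo] at this)
    have := ih (j + 1) (cellStep A j st) hinv1 hb1 hsz
    rwa [show j + 1 + fuel = j + (fuel + 1) by omega] at this

/-- **`stage1` collects every cell `j < Jt`.** [this cell, TIER2-KERNEL-SPEC §5 (K1)] -/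
theorem stage1_bounds (A : Inp) {θ₀ τ M₀ M₁₀ c₂ ε R Rm : ℝ} (hA : CellAtoms A θ₀ τ M₀ M₁₀ c₂ ε R Rm)
    (he : S ≤ A.etL) (heH : S ≤ A.etH) (h1 : val A.th0L ≤ θ₀) (h2 : θ₀ ≤ val A.th0H) (h0 : 0 < A.th0L)
    (hsz : (A.K : ℝ) * val (stage1 A).hi ≤ 2 ^ 24)
    {cb cpb : ℕ → ℝ} (hcb : ∀ i, 0 ≤ cb i ∧ cb i ≤ val (cutC A i)) (hcpb : ∀ i, 0 ≤ cpb i ∧ cpb i ≤ val (cutCp A i)) :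
    CellBounds A θ₀ τ M₀ M₁₀ c₂ ε R Rm cb cpb A.Jt (stage1 A) := by
  unfold stage1 at hsz ⊢
  have := cellLoop_bounds A hA he heH hcb hcpb A.Jt 0 _ (stage1_init_inv A (τ := τ) h1 h2 h0)
    (CellBounds.init A θ₀ τ M₀ M₁₀ c₂ ε R Rm cb cpb A.th0L A.th0H S S S S) hsz
  rwa [Nat.zero_add] at this

/-- The size side condition in decidable form: `K·(stage1 A).hi ≤ 2²⁴·S` (naturals) gives the real hypothesis of `stage1_bounds`. [this cell] -/
theorem stage1_size_of_nat (A : Inp) (h : A.K * (stage1 A).hi ≤ 2 ^ 24 * S) : (A.K : ℝ) * val (stage1 A).hi ≤ 2 ^ 24 := by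
  have h1 := val_mono h
  rw [val_nat_mul, val_nat_mul, val_S, mul_one] at h1
  exact_mod_cast h1

/-! ## The exported sequences -/

/-- `envS A j = val S_j` — the kernel's cell bound of `S(t)` on cell `j` (`0` past `Jt`). [this cell, TIER2-KERNEL-SPEC §5] -/
noncomputable def envS (A : Inp) (j : ℕ) : ℝ := val ((stage1 A).sRev.reverse.getD j 0)

/-- `envE A j = val e_j` — the kernel's cell envelope of `e(t)` on cell `j` (`0` past `Jt`). [this cell, TIER2-KERNEL-SPEC §5] -/
noncomputable def envE (A : Inp) (j : ℕ) : ℝ := val ((stage1 A).eRev.reverse.getD j 0)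

/-- `envEp A j = val e′_j` — the kernel's cell envelope of `e′(t)` on cell `j` (`0` past `Jt`). [this cell, TIER2-KERNEL-SPEC §5] -/
noncomputable def envEp (A : Inp) (j : ℕ) : ℝ := val ((stage1 A).epRev.reverse.getD j 0)

/-- The exported sequences are nonnegative. [this cell] -/
theorem envS_nonneg (A : Inp) (j : ℕ) : 0 ≤ envS A j := val_nonneg _

/-- The exported sequences are nonnegative. [this cell] -/
theorem envE_nonneg (A : Inp) (j : ℕ) : 0 ≤ envE A j := val_nonneg _

/-- The exported sequences are nonnegative. [this cell] -/
theorem envEp_nonneg (A : Inp) (j : ℕ) : 0 ≤ envEp A j := val_nonneg _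

/-- The three lists of `stage1 A` have length `Jt`. [this cell] -/
theorem stage1_lengths (A : Inp) :
    (stage1 A).sRev.length = A.Jt ∧ (stage1 A).eRev.length = A.Jt ∧ (stage1 A).epRev.length = A.Jt := by
  -- lengths do not depend on the real data: run `cellLoop_bounds`'s length bookkeeping with trivial reals is not available
  -- (it needs the atoms), so count directly along the loop
  suffices h : ∀ fuel j : ℕ, ∀ st : St, st.sRev.length = j ∧ st.eRev.length = j ∧ st.epRev.length = j →
      (cellLoop A fuel j st).sRev.length = j + fuel ∧ (cellLoop A fuel j st).eRev.length = j + fuel ∧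
        (cellLoop A fuel j st).epRev.length = j + fuel by
    have := h A.Jt 0
      { lo := A.th0L, hi := A.th0H, emh := S, em := S, em1 := S, eh := S, eRev := [], epRev := [], sRev := [] } ⟨rfl, rfl, rfl⟩
    rw [Nat.zero_add] at this
    unfold stage1
    exact this
  intro fuel
  induction fuel with
  | zero => intro j st h; rw [cellLoop_zero]; simpa using h
  | succ fuel ih =>
    intro j st h
    rw [cellLoop_succ]
    obtain ⟨hs, he, hep⟩ := cellStep_heads A j st
    have h1 : (cellStep A j st).sRev.length = j + 1 ∧ (cellStep A j st).eRev.length = j + 1 ∧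
        (cellStep A j st).epRev.length = j + 1 := by
      rw [hs, he, hep, List.length_cons, List.length_cons, List.length_cons, h.1, h.2.1, h.2.2]
      exact ⟨rfl, rfl, rfl⟩
    have := ih (j + 1) (cellStep A j st) h1
    rwa [show j + 1 + fuel = j + (fuel + 1) by omega] at this

/-- **(K1) for `S`**: `S(t) ≤ envS A j` on the closed cell `j < Jt`. [this cell, TIER2-KERNEL-SPEC §5 (K1)] -/
theorem stage1_envS_le (A : Inp) {θ₀ τ M₀ M₁₀ c₂ ε R Rm : ℝ} (hA : CellAtoms A θ₀ τ M₀ M₁₀ c₂ ε R Rm)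
    (he : S ≤ A.etL) (heH : S ≤ A.etH) (h1 : val A.th0L ≤ θ₀) (h2 : θ₀ ≤ val A.th0H) (h0 : 0 < A.th0L)
    (hsz : (A.K : ℝ) * val (stage1 A).hi ≤ 2 ^ 24)
    {j : ℕ} (hj : j < A.Jt) {t : ℝ} (ht1 : (j : ℝ) * τ ≤ t) (ht2 : t ≤ ((j : ℝ) + 1) * τ) :
    Sfun θ₀ R A.m A.K t ≤ envS A j :=
  (stage1_bounds A hA he heH h1 h2 h0 hsz (cb := fun i => val (cutC A i)) (cpb := fun i => val (cutCp A i))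
    (fun _ => ⟨val_nonneg _, le_rfl⟩) (fun _ => ⟨val_nonneg _, le_rfl⟩)).S_le j hj t ht1 ht2

/-- **(K1) for `e`**: `e^{−(m+½)t}·S(t)·c̄_j ≤ envE A j` on the closed cell `j < Jt`, for cut values `0 ≤ c̄_i ≤ val (cutC A i)`.
[this cell, TIER2-KERNEL-SPEC §5 (K1)] -/
theorem stage1_envE_le (A : Inp) {θ₀ τ M₀ M₁₀ c₂ ε R Rm : ℝ} (hA : CellAtoms A θ₀ τ M₀ M₁₀ c₂ ε R Rm)
    (he : S ≤ A.etL) (heH : S ≤ A.etH) (h1 : val A.th0L ≤ θ₀) (h2 : θ₀ ≤ val A.th0H) (h0 : 0 < A.th0L)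
    (hsz : (A.K : ℝ) * val (stage1 A).hi ≤ 2 ^ 24)
    {cb : ℕ → ℝ} (hcb : ∀ i, 0 ≤ cb i ∧ cb i ≤ val (cutC A i))
    {j : ℕ} (hj : j < A.Jt) {t : ℝ} (ht1 : (j : ℝ) * τ ≤ t) (ht2 : t ≤ ((j : ℝ) + 1) * τ) :
    exp (-(A.m + 1 / 2 : ℝ) * t) * Sfun θ₀ R A.m A.K t * cb j ≤ envE A j :=
  (stage1_bounds A hA he heH h1 h2 h0 hsz hcb (cpb := fun i => val (cutCp A i))
    (fun _ => ⟨val_nonneg _, le_rfl⟩)).e_le j hj t ht1 ht2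

/-- **(K1) for `e′`**: the derivative envelope on the closed cell `j < Jt`, for cut values `c̄ ≤ val cutC`, `c̄′ ≤ val cutCp`.
[this cell, TIER2-KERNEL-SPEC §5 (K1)] -/
theorem stage1_envEp_le (A : Inp) {θ₀ τ M₀ M₁₀ c₂ ε R Rm : ℝ} (hA : CellAtoms A θ₀ τ M₀ M₁₀ c₂ ε R Rm)
    (he : S ≤ A.etL) (heH : S ≤ A.etH) (h1 : val A.th0L ≤ θ₀) (h2 : θ₀ ≤ val A.th0H) (h0 : 0 < A.th0L)
    (hsz : (A.K : ℝ) * val (stage1 A).hi ≤ 2 ^ 24)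
    {cb cpb : ℕ → ℝ} (hcb : ∀ i, 0 ≤ cb i ∧ cb i ≤ val (cutC A i)) (hcpb : ∀ i, 0 ≤ cpb i ∧ cpb i ≤ val (cutCp A i))
    {j : ℕ} (hj : j < A.Jt) {t : ℝ} (ht1 : (j : ℝ) * τ ≤ t) (ht2 : t ≤ ((j : ℝ) + 1) * τ) :
    exp (-(1 / 2 : ℝ) * t) * ((M₀ / 2 * exp (-(A.m : ℝ) * t) * Sfun θ₀ R A.m A.K t
        + M₁₀ * exp (-(A.m - 1 : ℝ) * t) * S1fun θ₀ c₂ ε Rm A.m A.K t) * cb j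
        + M₀ * exp (-(A.m : ℝ) * t) * Sfun θ₀ R A.m A.K t * cpb j) ≤ envEp A j :=
  (stage1_bounds A hA he heH h1 h2 h0 hsz hcb hcpb).ep_le j hj t ht1 ht2

end Summit.RiemannHypothesis.RiemannHypothesis.Theorems.ThetaTier2
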